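import Summits.QuantumFields.BalabanUV.T4Continuum.Support.NE7FlatSliceSourceDuality
import Summits.QuantumFields.BalabanUV.T4Continuum.Support.NE3CovariantLineSumsTower
import Summits.QuantumFields.BalabanUV.T4Continuum.Support.NE3SmoothRightInverseW
import Summits.QuantumFields.BalabanUV.T4Continuum.Support.NE3EnergyHessBilin
import HarnessLib

/-!
# NE7BalabanSliceSourceDuality — (KL-B) IN SOURCE FORM IS THE CURL ROW OF BAŁABAN's CONSTRAINED PROPAGATOR: the one-term letter on the straight slice `ker QbarIter_W`
# (any gauge side condition) in FUNCTIONAL form (F167∕F169∕F171's `hB`) follows from the same letter in SOURCE form — «`QbarIter X″ = 0`, `Gauge X″`, `hess_W(X″, ·) = ⟨H, ·⟩`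
# on the skew periodic straight-tangent tests, `‖H‖_∞ ≤ g` ⟹ `‖curl_W X″‖ ≤ K·g`» — with `K_B = card n · K` (and conversely with the same constant)
# (file 103 of the curved (APE), F173)

Cell `pub-balaban`, rung (B)+1 sub-cell t4, lineage `b2b-balaban-t4-ne7-p1` (CRUX PROVER NE7 #1 = OWNER of row NE7), generation 83; memo
`t4/b2b-balaban-t4-ne7-p1-g83/BALABAN-GAUGE-ROAD.md` §4.  A TWIN of F148 `NE7CombSliceSourceDuality` (comb slice) for Bałaban's straight slice: lineage #2's (137)
`NE7FlatSliceSourceDuality.exists_skewSource_of_l1DualBound` (an `ℓ¹`-bounded functional on a subspace of skew periodic fields is a skew periodic source `H` with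
`‖H‖_∞ ≤ card n·g`) on the submodule `{Y skew, periodic, QbarIter L (j+1) W Y = 0}` (row NE3's `QbarIter_add`, `QbarIter_smul`).
WHY.  By F166 a straight-tangent gauge-fixed `X″` with `Hess_W X″ = H″ + Qbar^*μ` IS `C_a H″`; so the SOURCE form of (KL-B) is literally «`‖curl_W C_a h‖_∞ ≤ K‖h‖_∞`» —
the statement NE9's rows deliver ([B9] Thm 3.3 TYPE).  The END consumes the FUNCTIONAL form; this file is the bridge, so the docking files can target the source form.
WHAT ([folklore]; 0 def, 0 sorry).  §1 **`balabanSliceLetter_of_sourceLetter`** (`K_B = card n·K`); §2 `sourceLetter_of_balabanSliceLetter` (converse, same constant).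
HONEST FRAMING (page 1): finite-dimensional duality; NO estimate; the source letter is a DISPLAYED HYPOTHESIS; nothing of Bałaban's asserted; (APE) on curved data NOT proved;
NOT ONE-STEP, NOT NE7; spine 0∕9; finite T⁴ rung (B)+1 — NOT infinite volume, NOT mass gap, NOT `BetaPertH`, NOT Clay.  Continuum YM on T⁴ ⇐ BetaPertH ∧ nine spine
estimates (0/9 proved); BetaPertH ⇐ (D1) ∧ (D4) ∧ CAP+tail; G-an2-4 gates asym, D1 and NE2/3/4.
-/

set_option autoImplicit false

open scoped BigOperators Matrix Matrix.Norms.L2Operator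
open NormedSpace Finset

namespace Summit.QuantumFields.BalabanUV.T4Continuum.NE7BalabanSliceSourceDuality

open Literature.MathematicalPhysics.QuantumFieldTheory.Balaban1983to89
open B7Prop1Explicit B7Prop2Explicit UnitaryModel MatrixNorms
open T4AveragingDeficitWall (Ad IsUnitaryCfg IsSkewDir SmallField curlAt dirL1)
open T4AveragingDeficitWallBoundary (IsPeriodicCfg periodBox)
open AveragingDeficitPeriodicCounting (IsPeriodicDir)
open AveragingDeficitMultiLevelPrep (LevelSmall)
open MinimalActionLevels (perWin)
open NE3HessForm (hess)
open NE3TangentCovariantTower (QbarIter)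
open NE3EnergyHessBilin (hessBilin hessBilin_apply)
open NE3CovariantLineSumsTower (QbarIter_add)
open NE3SmoothRightInverseW (QbarIter_smul)
open NE7FlatSliceSourceDuality (srcPair abs_srcPair_le exists_skewSource_of_l1DualBound)

noncomputable section

variable {d : ℕ} {n : Type*} [Fintype n] [DecidableEq n]

/-! ## §1 Functional form from source form on Bałaban's slice -/

/-- **(KL-B) FROM ITS SOURCE FORM** (`K_B = card n·K`): if for every skew periodic straight-tangent gauge-fixed `X″` and every skew periodic source `H` with `‖H‖_∞ ≤ g`
REPRESENTING the slice functional (`hess W X″ Y = ⟨H, Y⟩` on the skew periodic straight-tangent tests) one has `‖curl_W X″‖ ≤ K·g`, then the functional-form letter of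
F167∕F169∕F171 holds with `K_B = card n·K`. [folklore] -/
theorem balabanSliceLetter_of_sourceLetter [Nonempty n] {L N : ℕ} [NeZero N] (hL : 1 ≤ L) (j : ℕ)
    {W : Site d → Fin d → (Matrix n n ℂ)ˣ} {x : ℝ} (hWu : IsUnitaryCfg W) (hx : 0 ≤ x) (hs : LevelSmall d L j x) (hWx : SmallField W x)
    (Gauge : (Site d → Fin d → Matrix n n ℂ) → Prop) {K : ℝ}
    (hSrc : ∀ X'' : Site d → Fin d → Matrix n n ℂ, IsSkewDir X'' → IsPeriodicDir X'' ((N * L ^ (j + 1) : ℕ) : ℤ) → QbarIter L (j + 1) W X'' = 0 → Gauge X'' →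
      ∀ H : Site d → Fin d → Matrix n n ℂ, IsSkewDir H → IsPeriodicDir H ((N * L ^ (j + 1) : ℕ) : ℤ) → ∀ g : ℝ, 0 ≤ g → (∀ (y : Site d) (κ : Fin d), ‖H y κ‖ ≤ g) →
      (∀ Y : Site d → Fin d → Matrix n n ℂ, IsSkewDir Y → IsPeriodicDir Y ((N * L ^ (j + 1) : ℕ) : ℤ) → QbarIter L (j + 1) W Y = 0 →
        hess W X'' Y (perWin d (N * L ^ (j + 1))) = srcPair H Y (periodBox (d := d) (N * L ^ (j + 1)))) →
      ∀ z μ' ν', μ' ≠ ν' → ‖curlAt W X'' z μ' ν'‖ ≤ K * g) :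
    ∀ X'' : Site d → Fin d → Matrix n n ℂ, IsSkewDir X'' → IsPeriodicDir X'' ((N * L ^ (j + 1) : ℕ) : ℤ) → QbarIter L (j + 1) W X'' = 0 → Gauge X'' →
      ∀ g'' : ℝ, 0 ≤ g'' →
      (∀ Y : Site d → Fin d → Matrix n n ℂ, IsSkewDir Y → IsPeriodicDir Y ((N * L ^ (j + 1) : ℕ) : ℤ) → QbarIter L (j + 1) W Y = 0 →
        |hess W X'' Y (perWin d (N * L ^ (j + 1)))| ≤ g'' * dirL1 Y (periodBox (d := d) (N * L ^ (j + 1)))) →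
      ∀ z μ' ν', μ' ≠ ν' → ‖curlAt W X'' z μ' ν'‖ ≤ (Fintype.card n * K) * g'' := by
  intro X hXs hXP hXQ hXG g hg hfun z μ' ν' hne
  haveI : NeZero (N * L ^ (j + 1)) := ⟨Nat.mul_ne_zero (NeZero.ne N) (pow_ne_zero _ (by omega))⟩
  -- the straight-tangent skew periodic fields as a real subspace
  let S : Submodule ℝ (Site d → Fin d → (Matrix n n ℂ)) :=
    { carrier := {Y | IsSkewDir Y ∧ IsPeriodicDir Y ((N * L ^ (j + 1) : ℕ) : ℤ) ∧ QbarIter L (j + 1) W Y = 0}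
      add_mem' := by
        rintro Y Z ⟨hYs, hYP, hYT⟩ ⟨hZs, hZP, hZT⟩
        refine ⟨fun y κ => (skewAdjoint (Matrix n n ℂ)).add_mem (hYs y κ) (hZs y κ), fun y κ μ => ?_, ?_⟩
        · show Y (y + ((N * L ^ (j + 1) : ℕ) : ℤ) • e κ) μ + Z (y + ((N * L ^ (j + 1) : ℕ) : ℤ) • e κ) μ = Y y μ + Z y μ
          rw [hYP, hZP]
        · have h := QbarIter_add hL j hWu hx hs hWx Y Z
          have hYZ : (fun y μ => Y y μ + Z y μ) = Y + Z := rfl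
          rw [hYZ] at h
          rw [h]
          funext z' κ'
          rw [hYT, hZT]
          simp
      zero_mem' := by
        refine ⟨fun y κ => (skewAdjoint (Matrix n n ℂ)).zero_mem, fun y κ μ => rfl, ?_⟩
        have h := QbarIter_smul hL j hWu hx hs hWx 0 0
        rwa [zero_smul, zero_smul] at h
      smul_mem' := by
        rintro c Y ⟨hYs, hYP, hYT⟩
        refine ⟨fun y κ => skewAdjoint.smul_mem c (hYs y κ), fun y κ μ => ?_, ?_⟩
        · show c • Y (y + ((N * L ^ (j + 1) : ℕ) : ℤ) • e κ) μ = c • Y y μ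
          rw [hYP]
        · rw [QbarIter_smul hL j hWu hx hs hWx c Y, hYT, smul_zero] }
  obtain ⟨H, hHs, hHP, hHb, hrep⟩ := exists_skewSource_of_l1DualBound (N * L ^ (j + 1)) S (fun Y hY => hY.1)
    (fun Y hY => hY.2.1) (hessBilin W (perWin d (N * L ^ (j + 1))) X) hg
    (fun Y hY => by rw [hessBilin_apply]; exact hfun Y hY.1 hY.2.1 hY.2.2)
  have h := hSrc X hXs hXP hXQ hXG H hHs hHP (Fintype.card n * g) (by positivity) hHb
    (fun Y hYs hYP hYT => by rw [← hessBilin_apply]; exact hrep Y ⟨hYs, hYP, hYT⟩) z μ' ν' hne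
  calc ‖curlAt W X z μ' ν'‖ ≤ K * (Fintype.card n * g) := h
    _ = Fintype.card n * K * g := by ring

/-! ## §2 The converse -/

/-- **THE CONVERSE**: the functional-form letter with `K_B` implies the source-form letter with the same constant (`|⟨H, Y⟩| ≤ ‖H‖_∞‖Y‖₁`). [folklore] -/
theorem sourceLetter_of_balabanSliceLetter {L N : ℕ} (j : ℕ) {W : Site d → Fin d → (Matrix n n ℂ)ˣ}
    (Gauge : (Site d → Fin d → Matrix n n ℂ) → Prop) {KB : ℝ}
    (hB : ∀ X'' : Site d → Fin d → Matrix n n ℂ, IsSkewDir X'' → IsPeriodicDir X'' ((N * L ^ (j + 1) : ℕ) : ℤ) → QbarIter L (j + 1) W X'' = 0 → Gauge X'' →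
      ∀ g'' : ℝ, 0 ≤ g'' →
      (∀ Y : Site d → Fin d → Matrix n n ℂ, IsSkewDir Y → IsPeriodicDir Y ((N * L ^ (j + 1) : ℕ) : ℤ) → QbarIter L (j + 1) W Y = 0 →
        |hess W X'' Y (perWin d (N * L ^ (j + 1)))| ≤ g'' * dirL1 Y (periodBox (d := d) (N * L ^ (j + 1)))) →
      ∀ z μ' ν', μ' ≠ ν' → ‖curlAt W X'' z μ' ν'‖ ≤ KB * g'') :
    ∀ X'' : Site d → Fin d → Matrix n n ℂ, IsSkewDir X'' → IsPeriodicDir X'' ((N * L ^ (j + 1) : ℕ) : ℤ) → QbarIter L (j + 1) W X'' = 0 → Gauge X'' →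
      ∀ H : Site d → Fin d → Matrix n n ℂ, IsSkewDir H → IsPeriodicDir H ((N * L ^ (j + 1) : ℕ) : ℤ) → ∀ g : ℝ, 0 ≤ g → (∀ (y : Site d) (κ : Fin d), ‖H y κ‖ ≤ g) →
      (∀ Y : Site d → Fin d → Matrix n n ℂ, IsSkewDir Y → IsPeriodicDir Y ((N * L ^ (j + 1) : ℕ) : ℤ) → QbarIter L (j + 1) W Y = 0 →
        hess W X'' Y (perWin d (N * L ^ (j + 1))) = srcPair H Y (periodBox (d := d) (N * L ^ (j + 1)))) →
      ∀ z μ' ν', μ' ≠ ν' → ‖curlAt W X'' z μ' ν'‖ ≤ KB * g := by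
  intro X hXs hXP hXQ hXG H _ _ g hg hHb hrep z μ' ν' hne
  exact hB X hXs hXP hXQ hXG g hg (fun Y hYs hYP hYT => by rw [hrep Y hYs hYP hYT]; exact abs_srcPair_le hHb) z μ' ν' hne

end

end Summit.QuantumFields.BalabanUV.T4Continuum.NE7BalabanSliceSourceDuality
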